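import Mathlib.NumberTheory.NumberField.DedekindZeta
import Mathlib.NumberTheory.NumberField.Discriminant.Different
import Mathlib.NumberTheory.RamificationInertia.Inertia
import Mathlib.NumberTheory.RamificationInertia.Unramified
import Mathlib.FieldTheory.Galois.Basic
import Mathlib.Algebra.Group.ConjFinite
import HarnessLib

/-!
# Arithmetically equivalent number fields (Perlis 1977): equal zeta functions, splitting types,
# Gassmann triples, and solitariness in degree `≤ 6`

Topic `NumberTheory/NumberFields` (namespace `Literature.NumberTheory.NumberFields`). Ledger item
`wi-18521` (consumer: route Langlands/E8QuinticResidue, crux `NoChimeras` = stmt-Langlands-8668).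
Source: R. Perlis, *On the equation `ζ_K(s) = ζ_{K'}(s)`*, J. Number Theory **9** (1977) 342–360
(bib key `Perlis1977`), read from the materialised text (§1, Theorem 1, pp. 343–347; §4,
Theorems 2–3, pp. 353–356).

## Contents

Definitions (with bodies):
* `IsGassmannEquivalent H H'` — subgroups `H, H'` of a group `G` meet every conjugacy class of `G`
  in the same number of elements (Perlis §1, "Gassmann equivalent in `G`"); API: an equivalence
  relation, conjugate subgroups are Gassmann equivalent (`map_conj`), and Gassmann-equivalent
  subgroups of a finite group have the same order (`card_eq`, all proved);
* `splittingType K p` — Perlis's SPLITTING TYPE of the rational prime `p` in the number field `K`: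
  the multiset `(f₁, …, f_g)` of inertia degrees of the DISTINCT primes `P₁, …, P_g` of `𝓞 K`
  dividing `p𝓞 K` (ramification indices deliberately ignored, as in the source, p. 343);
* `splittingNorms K p` — the multiset of absolute norms of the prime factors of `p𝓞 K` COUNTED
  WITH MULTIPLICITY, `(normalizedFactors (p𝓞 K)).map absNorm` (the datum used verbatim by the
  consumer route file `Summits/Langlands/Langlands/Theses/E8QuinticResidue.lean`);
* `ArithmeticallyEquivalent K K'` — every rational prime has the same splitting type in `K` and
  in `K'` (Perlis, Introduction and condition (b) of Theorem 1).

Named facts (D-0014; nothing is `sorry`d, nothing asserted):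
* `Perlis1977_thm1` — THEOREM 1: (a) `ζ_K = ζ_{K'}` ⇔ (b) arithmetic equivalence ⇔ (c) equal
  splitting types for all but finitely many `p` ⇔ (d) `Gal(N/K)`, `Gal(N/K')` Gassmann equivalent in
  `Gal(N/ℚ)` for a common finite Galois `N ⊇ K, K'`; and then `[K:ℚ] = [K':ℚ]`, `D_K = D_{K'}`, the
  numbers of real and of complex places agree, and `U_K ≅ U_{K'}`;
* `Perlis1977_thm3` — THEOREM 3: a number field of degree `≤ 6` is (arithmetically) SOLITARY, i.e.
  isomorphic to every arithmetically equivalent field.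

PROVED here (no hypotheses beyond the two facts where indicated):
* `ArithmeticallyEquivalent.of_algEquiv` — isomorphic number fields are arithmetically equivalent
  (via `normalizedFactors_map_ringEquiv`, `absNorm_map_ringEquiv`: factorisations and norms are
  transported by `𝓞 K ≃+* 𝓞 K'`), i.e. the converse of "solitary" is unconditional;
* `nodup_normalizedFactors_of_not_dvd_discr` — for `p ∤ D_K` the factorisation of `p𝓞 K` is
  squarefree (Mathlib's `NumberField.not_dvd_discr_iff_forall_liesOver` + `e = 1` for unramified
  primes); `eventually_not_dvd_discr` — this holds for all but finitely many `p`;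
* `splittingNorms_eq_map_of_nodup` — at such `p`, `splittingNorms K p = (splittingType K p).map (p ^ ·)`
  (`N(P) = p^{f(P|p)}`), whence `eventually_splittingType_eq_iff_splittingNorms`: conditions (c) in
  Perlis's form and in the route's norms form are EQUIVALENT (both are "almost all `p`" statements
  and almost every `p` is unramified in both fields);
* `Perlis1977_thm3.algEquiv_of_splittingNorms` — the consumer's rendering: from the two facts,
  `[K:ℚ] ≤ 6` and equal `splittingNorms` at almost all primes give `Nonempty (K ≃ₐ[ℚ] K')`.

## Faithfulness notes

* (a) is rendered as equality of Mathlib's Dirichlet series `NumberField.dedekindZeta K : ℂ → ℂ`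
  (`∑ aₙ n⁻ˢ`, `aₙ = #{I ⊆ 𝓞 K : N(I) = n}`) as FUNCTIONS; since an `L`-series is determined by
  its coefficients and conversely determines them on its half-plane of absolute convergence
  (`Re s > 1` here), this is the same as equality on `Re s > 1`, i.e. Perlis's `ζ_K(s) = ζ_{K'}(s)`.
* (b) MUST use Perlis's splitting type (distinct primes, inertia degrees only): arithmetically
  equivalent fields can have different ramification indices above the same `p` (Perlis §2,
  p. 351: in `ℚ(⁸√97)` and `ℚ(⁸√(16·97))` one has `2 = P₁P₂P₃²P₄⁴` resp. `Q₁²Q₂²Q₃²Q₄²`, all `f = 1`),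
  so "(b) with ramification indices at every `p`" would be a different, stronger condition.
  For the almost-all condition (c) the two data are interchangeable (proved here).
* (d) is stated for every finite Galois extension `N/ℚ` (a number field with `IsGalois ℚ N`) and
  every pair of `ℚ`-embeddings `K, K' → N`, with `H = Gal(N/K)` the fixing subgroup of the image.
  The two further invariants of Theorem 1, "same normal closure and same normal core over `ℚ`",
  follow group-theoretically from (d) (fixed fields of `normalCore H` / of the normal closure of
  `H`, Perlis p. 347) and are NOT vendored as facts.
* Fields are quantified over `Type` (universe `0`); every number field is isomorphic to one there.
* Perlis's Theorem 2 (seven sufficient criteria for solitariness) and the degree-`7` and degree-`8`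
  non-solitary examples (§§2–4) are not vendored (not requested).

## References

* [Perlis1977] R. Perlis, *On the equation `ζ_K(s) = ζ_{K'}(s)`*, J. Number Theory 9 (1977),
  342–360: §1 (splitting types, Gassmann's Lemma 1, Theorem 1), §4 (Theorems 2 and 3).
* F. Gassmann, *Bemerkungen zu der vorstehenden Arbeit von Hurwitz*, Math. Z. 25 (1926),
  124–143 (Gassmann equivalence; Perlis's reference [2], as printed in his bibliography).
* J. W. S. Cassels, A. Fröhlich (eds.), *Algebraic Number Theory*, Academic Press 1967,
  exercise 6 (Perlis's reference [1, exercise 6] for Theorem 1).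
-/

noncomputable section

open Ideal UniqueFactorizationMonoid NumberField Filter

namespace Literature.NumberTheory.NumberFields

/-! ## Gassmann equivalence of subgroups -/

/-- Two subgroups `H, H'` of a (finite) group `G` are GASSMANN EQUIVALENT in `G` when
`|c ∩ H| = |c ∩ H'|` for every conjugacy class `c = {g x g⁻¹ : g ∈ G}` of `G`; here: for every
`x : G`, the elements of `H` conjugate in `G` to `x` and the elements of `H'` conjugate in `G` to `x`
are equinumerous (`Nat.card`, so that nothing is asserted for infinite classes).
[cite: Perlis1977, §1 (definition preceding Lemma 1)] -/
def IsGassmannEquivalent {G : Type*} [Group G] (H H' : Subgroup G) : Prop :=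
  ∀ x : G, Nat.card {h : H // IsConj x (h : G)} = Nat.card {h : H' // IsConj x (h : G)}

namespace IsGassmannEquivalent

variable {G : Type*} [Group G]

/-- Gassmann equivalence is reflexive. [folklore] -/
protected theorem refl (H : Subgroup G) : IsGassmannEquivalent H H := fun _ => rfl

/-- Gassmann equivalence is symmetric. [folklore] -/
protected theorem symm {H H' : Subgroup G} (h : IsGassmannEquivalent H H') :
    IsGassmannEquivalent H' H := fun x => (h x).symm

/-- Gassmann equivalence is transitive. [folklore] -/
protected theorem trans {H H' H'' : Subgroup G} (h : IsGassmannEquivalent H H')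
    (h' : IsGassmannEquivalent H' H'') : IsGassmannEquivalent H H'' := fun x => (h x).trans (h' x)

/-- `|H| = Σ_c |c ∩ H|`, the sum over the conjugacy classes `c` of the finite group `G`.
[folklore] -/
theorem _root_.Literature.NumberTheory.NumberFields.card_eq_finsum_card_conjClasses [Finite G]
    (H : Subgroup G) :
    Nat.card H = ∑ᶠ c : ConjClasses G, Nat.card {h : H // ConjClasses.mk (h : G) = c} := by
  classical
  have := Fintype.ofFinite G
  have : Fintype (ConjClasses G) := Fintype.ofFinite _
  rw [finsum_eq_sum_of_fintype]
  simp_rw [Nat.card_eq_fintype_card]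
  rw [← Fintype.card_sigma]
  exact Fintype.card_congr (Equiv.sigmaFiberEquiv fun h : H => ConjClasses.mk (h : G)).symm

/-- Gassmann-equivalent subgroups of a finite group have the same order ("either condition
implies that `|H| = |H'|`", Perlis, proof of Lemma 1). [cite: Perlis1977, §1 (proof of Lemma 1)] -/
theorem card_eq [Finite G] {H H' : Subgroup G} (h : IsGassmannEquivalent H H') :
    Nat.card H = Nat.card H' := by
  rw [card_eq_finsum_card_conjClasses H, card_eq_finsum_card_conjClasses H']
  refine finsum_congr fun c => ?_
  obtain ⟨x, rfl⟩ := ConjClasses.mk_surjective c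
  have e1 : {k : H // ConjClasses.mk (k : G) = ConjClasses.mk x} ≃ {k : H // IsConj x (k : G)} :=
    Equiv.subtypeEquivRight fun k => by rw [ConjClasses.mk_eq_mk_iff_isConj]; exact isConj_comm
  have e2 : {k : H' // ConjClasses.mk (k : G) = ConjClasses.mk x} ≃ {k : H' // IsConj x (k : G)} :=
    Equiv.subtypeEquivRight fun k => by rw [ConjClasses.mk_eq_mk_iff_isConj]; exact isConj_comm
  rw [Nat.card_congr e1, Nat.card_congr e2, h x]

/-- Conjugate subgroups `H` and `gHg⁻¹` are Gassmann equivalent (the "trivial" Gassmann pairs;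
Perlis's non-solitary fields come from NON-conjugate Gassmann-equivalent subgroups).
[cite: Perlis1977, §2 (p. 347: "the corresponding groups … will not be conjugate")] -/
theorem map_conj (H : Subgroup G) (g : G) :
    IsGassmannEquivalent H (H.map (MulAut.conj g).toMonoidHom) := by
  intro x
  have hinj : Function.Injective (MulAut.conj g).toMonoidHom := (MulAut.conj g).injective
  refine Nat.card_congr (Equiv.subtypeEquiv (Subgroup.equivMapOfInjective H _ hinj).toEquiv ?_)
  intro h
  have hc : IsConj (h : G) (g * h * g⁻¹) := isConj_iff.2 ⟨g, rfl⟩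
  have hcoe : ((Subgroup.equivMapOfInjective H _ hinj).toEquiv h : G) = g * h * g⁻¹ := rfl
  rw [hcoe]
  exact ⟨fun hx => hx.trans hc, fun hx => hx.trans hc.symm⟩

end IsGassmannEquivalent

/-! ## Splitting types -/

section Splitting

variable (K : Type*) [Field K] [NumberField K]

/-- Perlis's SPLITTING TYPE of the rational prime `p` in the number field `K`: writing
`p𝓞 K = P₁^{e₁} ⋯ P_g^{e_g}` with distinct primes `Pᵢ` and inertia degrees `fᵢ = [𝓞 K/Pᵢ : 𝔽_p]`,
it is the tuple `A = (f₁, …, f_g)` up to order, i.e. the multiset of inertia degrees (over `ℤ`) of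
the distinct prime factors of `p𝓞 K` — "this definition ignores the ramification indices `eᵢ`".
(For `p` not prime the value is junk: `p = 0, 1` give `∅`.) [cite: Perlis1977, §1 (p. 343)] -/
def splittingType (p : ℕ) : Multiset ℕ :=
  ((normalizedFactors (span {(p : 𝓞 K)})).dedup).map fun P => P.inertiaDeg ℤ

/-- The NORMS FORM of the splitting datum: the multiset of absolute norms `N(P) = p^{f(P|p)}` of the
prime factors `P` of `p𝓞 K`, each repeated `e(P|p)` times (`normalizedFactors` counts with
multiplicity). At a prime `p` unramified in `K` this is `{p^{f₁}, …, p^{f_g}}`, the same information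
as `splittingType K p` (`splittingNorms_eq_map_of_nodup`). This is the datum used by the consumer
route (`E8QuinticResidue`, items `QuinticFieldOfPair`, `NoChimeras`). [folklore] -/
def splittingNorms (p : ℕ) : Multiset ℕ :=
  (normalizedFactors (span {(p : 𝓞 K)})).map absNorm

/-- Unfolding lemma for `splittingType`. [folklore] -/
theorem splittingType_def (p : ℕ) : splittingType K p =
    ((normalizedFactors (span {(p : 𝓞 K)})).dedup).map fun P => P.inertiaDeg ℤ := rfl

/-- Unfolding lemma for `splittingNorms`. [folklore] -/
theorem splittingNorms_def (p : ℕ) :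
    splittingNorms K p = (normalizedFactors (span {(p : 𝓞 K)})).map absNorm := rfl

end Splitting

/-- `K` and `K'` are ARITHMETICALLY EQUIVALENT when each prime number `p` has the same splitting
type in `K` as in `K'` (Perlis, Introduction; this is condition (b) of his Theorem 1, equivalent to
`ζ_K = ζ_{K'}` by that theorem, `Perlis1977_thm1`). [cite: Perlis1977, Introduction (p. 342) and Thm. 1(b)] -/
def ArithmeticallyEquivalent (K K' : Type*) [Field K] [NumberField K] [Field K'] [NumberField K'] :
    Prop :=
  ∀ p : ℕ, p.Prime → splittingType K p = splittingType K' p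

namespace ArithmeticallyEquivalent

variable {K K' K'' : Type*} [Field K] [NumberField K] [Field K'] [NumberField K']
  [Field K''] [NumberField K'']

/-- Arithmetic equivalence is reflexive. [folklore] -/
protected theorem refl (K : Type*) [Field K] [NumberField K] : ArithmeticallyEquivalent K K :=
  fun _ _ => rfl

/-- Arithmetic equivalence is symmetric. [folklore] -/
protected theorem symm (h : ArithmeticallyEquivalent K K') : ArithmeticallyEquivalent K' K :=
  fun p hp => (h p hp).symm

/-- Arithmetic equivalence is transitive. [folklore] -/
protected theorem trans (h : ArithmeticallyEquivalent K K') (h' : ArithmeticallyEquivalent K' K'') :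
    ArithmeticallyEquivalent K K'' :=
  fun p hp => (h p hp).trans (h' p hp)

end ArithmeticallyEquivalent

/-! ## Perlis's Theorems 1 and 3 (named facts) -/

/-- **Perlis 1977, Theorem 1 — NAMED FACT.** Printed statement (N ⊇ K, K' a finite normal extension
of `ℚ`, `G = Gal(N/ℚ)`, `H = Gal(N/K)`, `H' = Gal(N/K')`): "The following conditions are equivalent.
(a) `ζ_K(s) = ζ_{K'}(s)`. (b) `P_K(A) = P_{K'}(A)` for every tupel `A`. (c) `P_K(A) ≐ P_{K'}(A)` for
every tupel `A` [the two sets of primes of splitting type `A` differ by at most finitely many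
elements]. (d) `H` and `H'` are Gassmann equivalent. Furthermore, when these conditions hold then
`[K:ℚ] = [K':ℚ]`, the discriminants agree `D_K = D_{K'}`, the number of real (resp. complex)
valuations of `K` and `K'` coincide, the two fields determine the same normal closure and the same
normal core over `ℚ`, and the unit groups are isomorphic `U_K ≅ U_{K'}`." Rendering: (a) as
equality of Mathlib's Dirichlet series `NumberField.dedekindZeta` (functions `ℂ → ℂ`, equivalently
equality on `Re s > 1`); (b) = `ArithmeticallyEquivalent` (Perlis's splitting types, ramification
ignored); (c) = equal splitting types for all but finitely many primes (there are only finitely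
many tupels `A`, so this is Perlis's (c)); (d) for every finite Galois `N/ℚ` and `ℚ`-embeddings
`i : K → N`, `i' : K' → N`, with `H`, `H'` the fixing subgroups of the images; invariants: degree,
`NumberField.discr`, numbers of real/complex places, `(𝓞 K)ˣ ≃* (𝓞 K')ˣ` (the normal-closure /
normal-core clauses follow from (d) by Galois theory and are not part of this fact). The proof in
print uses the Euler product and functional equation of `ζ_K` and the Frobenius/Chebotarev density
theorem, none of which Mathlib has for general `K`. [cite: Perlis1977, Thm. 1 (pp. 345–347)] -/
def Perlis1977_thm1 : Prop :=
  ∀ (K K' : Type) [Field K] [NumberField K] [Field K'] [NumberField K'],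
    (NumberField.dedekindZeta K = NumberField.dedekindZeta K' ↔ ArithmeticallyEquivalent K K') ∧
    (ArithmeticallyEquivalent K K' ↔
      ∀ᶠ p : ℕ in cofinite, p.Prime → splittingType K p = splittingType K' p) ∧
    (∀ (N : Type) [Field N] [NumberField N] [IsGalois ℚ N] (i : K →ₐ[ℚ] N) (i' : K' →ₐ[ℚ] N),
      ArithmeticallyEquivalent K K' ↔
        IsGassmannEquivalent i.fieldRange.fixingSubgroup i'.fieldRange.fixingSubgroup) ∧
    (ArithmeticallyEquivalent K K' →
      Module.finrank ℚ K = Module.finrank ℚ K' ∧ NumberField.discr K = NumberField.discr K' ∧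
      NumberField.InfinitePlace.nrRealPlaces K = NumberField.InfinitePlace.nrRealPlaces K' ∧
      NumberField.InfinitePlace.nrComplexPlaces K = NumberField.InfinitePlace.nrComplexPlaces K' ∧
      Nonempty ((𝓞 K)ˣ ≃* (𝓞 K')ˣ))

/-- **Perlis 1977, Theorem 3 — NAMED FACT.** "If `[K : ℚ] ≤ 6` then `K` is solitary", where a field
`K` is (arithmetically) SOLITARY when it is isomorphic to any field `K'` arithmetically equivalent
to it (Perlis p. 347; the first non-solitary fields have degree `7`, §4). Rendering: for number
fields `K, K'` with `finrank ℚ K ≤ 6`, `ArithmeticallyEquivalent K K'` gives a `ℚ`-algebra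
isomorphism `K ≃ₐ[ℚ] K'`. The printed proof goes through (b) ⇒ (d) of Theorem 1 and the
conjugacy of Gassmann-equivalent subgroups of index `≤ 6` in the transitive groups of degree `≤ 6`
(Theorem 2). For the hypothesis in the consumer's norms form see
`Perlis1977_thm3.algEquiv_of_splittingNorms`. [cite: Perlis1977, Thm. 3 (p. 355) with §1 (p. 347, "solitary")] -/
def Perlis1977_thm3 : Prop :=
  ∀ (K K' : Type) [Field K] [NumberField K] [Field K'] [NumberField K'],
    Module.finrank ℚ K ≤ 6 → ArithmeticallyEquivalent K K' → Nonempty (K ≃ₐ[ℚ] K')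

/-! ## Proved: unramified primes, and the two forms of condition (c) -/

section Proofs

variable {K : Type*} [Field K] [NumberField K]

omit [NumberField K] in
/-- `p𝓞 K` is the extension of `pℤ`. [folklore] -/
theorem map_span_natCast (p : ℕ) :
    (span {(p : ℤ)}).map (algebraMap ℤ (𝓞 K)) = span {(p : 𝓞 K)} := by
  rw [Ideal.map_span, Set.image_singleton, map_natCast]

/-- The prime factors of `p𝓞 K` are exactly the primes of `𝓞 K` lying over `pℤ`. [folklore] -/
theorem mem_normalizedFactors_span_iff {p : ℕ} (hp : p.Prime) {P : Ideal (𝓞 K)} :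
    P ∈ normalizedFactors (span {(p : 𝓞 K)}) ↔ P.IsPrime ∧ P.LiesOver (span {(p : ℤ)}) := by
  haveI : (span {(p : ℤ)}).IsMaximal :=
    PrincipalIdealRing.isMaximal_of_irreducible (Nat.prime_iff_prime_int.mp hp).irreducible
  have hp0 : span {(p : ℤ)} ≠ ⊥ := by
    rw [Ne, span_singleton_eq_bot]
    exact_mod_cast hp.ne_zero
  rw [← map_span_natCast, ← Ideal.mem_primesOver_iff_mem_normalizedFactors (𝓞 K) hp0]
  rfl

/-- A prime factor of `p𝓞 K` is a nonzero (hence maximal) ideal. [folklore] -/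
theorem ne_bot_of_mem_normalizedFactors_span {p : ℕ} (hp : p.Prime) {P : Ideal (𝓞 K)}
    (hP : P ∈ normalizedFactors (span {(p : 𝓞 K)})) : P ≠ ⊥ := by
  rintro rfl
  have h := dvd_of_mem_normalizedFactors hP
  rw [← Ideal.zero_eq_bot, zero_dvd_iff, Ideal.zero_eq_bot, span_singleton_eq_bot] at h
  exact hp.ne_zero (by exact_mod_cast h)

/-! ### Invariance under isomorphisms: isomorphic fields are arithmetically equivalent -/

section RingEquiv

variable {R S : Type*} [CommRing R] [CommRing S]

/-- `Ideal.map` along a ring isomorphism is injective. [folklore] -/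
theorem map_ringEquiv_injective (E : R ≃+* S) :
    Function.Injective (Ideal.map (E : R →+* S)) := by
  intro I J h
  have := congrArg (Ideal.map (E.symm : S →+* R)) h
  rwa [Ideal.map_of_equiv, Ideal.map_of_equiv] at this

/-- The absolute norm of an ideal is invariant under ring isomorphisms (`R/I ≃ S/E(I)`).
[folklore] -/
theorem absNorm_map_ringEquiv [IsDedekindDomain R] [Module.Free ℤ R] [Module.Finite ℤ R]
    [IsDedekindDomain S] [Module.Free ℤ S] [Module.Finite ℤ S] (E : R ≃+* S) (I : Ideal R) :
    absNorm (I.map (E : R →+* S)) = absNorm I := by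
  rw [absNorm_apply, absNorm_apply, Submodule.cardQuot_apply, Submodule.cardQuot_apply]
  exact (Nat.card_congr (Ideal.quotientEquiv I (I.map (E : R →+* S)) E rfl).toEquiv).symm

/-- Prime factorisations of nonzero ideals of Dedekind domains are transported by ring
isomorphisms: `normalizedFactors (E(I)) = (normalizedFactors I).map E`. [folklore] -/
theorem normalizedFactors_map_ringEquiv [IsDedekindDomain R] [IsDedekindDomain S] (E : R ≃+* S)
    {I : Ideal R} (hI : I ≠ ⊥) :
    normalizedFactors (I.map (E : R →+* S)) =
      (normalizedFactors I).map (Ideal.map (E : R →+* S)) := by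
  have h1 : I.map (E : R →+* S) = ((normalizedFactors I).map (Ideal.map (E : R →+* S))).prod := by
    conv_lhs => rw [← associated_iff_eq.mp (prod_normalizedFactors hI)]
    exact (Multiset.prod_hom (normalizedFactors I) (Ideal.mapHom (E : R →+* S))).symm
  rw [h1, normalizedFactors_prod_eq, Multiset.map_congr rfl fun x _ => normalize_eq x,
    Multiset.map_id']
  intro Q hQ
  obtain ⟨P, hP, rfl⟩ := Multiset.mem_map.1 hQ
  have hPp : P.IsPrime := isPrime_of_prime (prime_of_normalized_factor P hP)
  have hP0 : P ≠ ⊥ := (prime_of_normalized_factor P hP).ne_zero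
  have hQ0 : P.map (E : R →+* S) ≠ ⊥ := fun h =>
    hP0 (map_ringEquiv_injective E (h.trans (Ideal.map_bot (f := (E : R →+* S))).symm))
  exact (Ideal.prime_of_isPrime hQ0 (Ideal.map_isPrime_of_equiv E)).irreducible

end RingEquiv

omit [NumberField K] in
/-- `p𝓞 K'` is the image of `p𝓞 K` under any ring isomorphism `𝓞 K ≃ 𝓞 K'`. [folklore] -/
theorem span_natCast_eq_map_ringEquiv {K' : Type*} [Field K'] (E : 𝓞 K ≃+* 𝓞 K') (p : ℕ) :
    span {(p : 𝓞 K')} = (span {(p : 𝓞 K)}).map (E : 𝓞 K →+* 𝓞 K') := by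
  rw [Ideal.map_span, Set.image_singleton, map_natCast]

/-- Splitting types are invariant under ring isomorphisms of the rings of integers (the prime
factors correspond under `E`, and `N(E(P)) = N(P)` forces `f(E(P)|p) = f(P|p)`). [folklore] -/
theorem splittingType_eq_of_ringEquiv {K' : Type*} [Field K'] [NumberField K']
    (E : 𝓞 K ≃+* 𝓞 K') {p : ℕ} (hp : p.Prime) : splittingType K p = splittingType K' p := by
  classical
  have hI : span {(p : 𝓞 K)} ≠ ⊥ := by
    rw [Ne, span_singleton_eq_bot]
    exact_mod_cast hp.ne_zero
  rw [splittingType, splittingType, span_natCast_eq_map_ringEquiv E,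
    normalizedFactors_map_ringEquiv E hI,
    Multiset.dedup_map_of_injective (map_ringEquiv_injective E), Multiset.map_map]
  refine Multiset.map_congr rfl fun P hP => ?_
  rw [Multiset.mem_dedup] at hP
  obtain ⟨hPp, hPl⟩ := (mem_normalizedFactors_span_iff hp).1 hP
  have hQ : P.map (E : 𝓞 K →+* 𝓞 K') ∈ normalizedFactors (span {(p : 𝓞 K')}) := by
    rw [span_natCast_eq_map_ringEquiv E, normalizedFactors_map_ringEquiv E hI]
    exact Multiset.mem_map_of_mem _ hP
  obtain ⟨hQp, hQl⟩ := (mem_normalizedFactors_span_iff hp).1 hQ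
  simp only [Function.comp_apply]
  apply Nat.pow_right_injective hp.two_le
  simp only
  rw [Ideal.pow_inertiaDeg p, Ideal.pow_inertiaDeg p, absNorm_map_ringEquiv]

/-- The norms data are invariant under ring isomorphisms of the rings of integers. [folklore] -/
theorem splittingNorms_eq_of_ringEquiv {K' : Type*} [Field K'] [NumberField K']
    (E : 𝓞 K ≃+* 𝓞 K') {p : ℕ} (hp : p.Prime) : splittingNorms K p = splittingNorms K' p := by
  have hI : span {(p : 𝓞 K)} ≠ ⊥ := by
    rw [Ne, span_singleton_eq_bot]
    exact_mod_cast hp.ne_zero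
  rw [splittingNorms, splittingNorms, span_natCast_eq_map_ringEquiv E,
    normalizedFactors_map_ringEquiv E hI, Multiset.map_map]
  exact Multiset.map_congr rfl fun P _ => (absNorm_map_ringEquiv E P).symm

/-- **Isomorphic number fields are arithmetically equivalent** (the trivial direction of
"solitary"; a `ℚ`-isomorphism `K ≃ K'` restricts to `𝓞 K ≃ 𝓞 K'`). [cite: Perlis1977, Introduction (p. 342: "isomorphic fields have identical zeta functions")] -/
theorem ArithmeticallyEquivalent.of_algEquiv {K' : Type*} [Field K'] [NumberField K']
    (e : K ≃ₐ[ℚ] K') : ArithmeticallyEquivalent K K' :=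
  fun _ hp => splittingType_eq_of_ringEquiv (NumberField.RingOfIntegers.mapRingEquiv e.toRingEquiv) hp

/-- **Non-vacuity / sanity of the norms datum.** For `p ≠ 0` the norms of the prime factors of
`p𝓞 K`, with multiplicity, multiply to `N(p𝓞 K) = p^{[K:ℚ]}` (so `splittingNorms K p ≠ ∅` for a
prime `p`, and `∑ eᵢ fᵢ = [K:ℚ]`). [folklore] -/
theorem prod_splittingNorms (p : ℕ) (hp : p ≠ 0) :
    (splittingNorms K p).prod = p ^ Module.finrank ℚ K := by
  have hI : span {(p : 𝓞 K)} ≠ ⊥ := by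
    rw [Ne, span_singleton_eq_bot]
    exact_mod_cast hp
  rw [splittingNorms, Multiset.prod_hom, associated_iff_eq.mp (prod_normalizedFactors hI),
    Ideal.absNorm_span_singleton, ← map_natCast (algebraMap ℤ (𝓞 K)) p, Algebra.norm_algebraMap,
    Int.natAbs_pow, Int.natAbs_natCast, NumberField.RingOfIntegers.rank]

/-- **Unramified primes factor squarefreely.** If `p ∤ D_K` then `p𝓞 K = P₁ ⋯ P_g` with DISTINCT
primes, i.e. the multiset of prime factors of `p𝓞 K` has no repetition (all `e(Pᵢ|p) = 1`, by
Mathlib's `NumberField.not_dvd_discr_iff_forall_liesOver`). [folklore] -/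
theorem nodup_normalizedFactors_of_not_dvd_discr {p : ℕ} (hp : p.Prime)
    (hd : ¬ (p : ℤ) ∣ NumberField.discr K) : (normalizedFactors (span {(p : 𝓞 K)})).Nodup := by
  classical
  rw [Multiset.nodup_iff_count_le_one]
  intro P
  by_cases hP : P ∈ normalizedFactors (span {(p : 𝓞 K)})
  · obtain ⟨hPp, hPl⟩ := (mem_normalizedFactors_span_iff hp).1 hP
    haveI : P.IsMaximal := hPp.isMaximal (ne_bot_of_mem_normalizedFactors_span hp hP)
    haveI : Algebra.IsUnramifiedAt ℤ P :=
      (NumberField.not_dvd_discr_iff_forall_liesOver K (𝓞 K) (Nat.prime_iff_prime_int.mp hp)).1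
        hd P inferInstance hPl
    have hmap : (span {(p : ℤ)}).map (algebraMap ℤ (𝓞 K)) ≠ ⊥ := by
      rw [map_span_natCast, Ne, span_singleton_eq_bot]
      exact_mod_cast hp.ne_zero
    have hcount :=
      Ideal.IsDedekindDomain.ramificationIdx_eq_normalizedFactors_count (span {(p : ℤ)}) P hmap
    rw [map_span_natCast, Ideal.ramificationIdx_eq_one_of_isUnramifiedAt] at hcount
    omega
  · rw [Multiset.count_eq_zero_of_notMem hP]
    exact zero_le_one

variable (K) in
/-- All but finitely many rational `p` do not divide the (nonzero) discriminant `D_K`; in particular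
almost every prime is unramified in `K`. [folklore] -/
theorem eventually_not_dvd_discr : ∀ᶠ p : ℕ in cofinite, ¬ (p : ℤ) ∣ NumberField.discr K := by
  rw [Filter.eventually_cofinite]
  refine (Set.finite_Iic (NumberField.discr K).natAbs).subset fun p hp => ?_
  simp only [Set.mem_setOf_eq, not_not] at hp
  exact Nat.le_of_dvd (Int.natAbs_pos.mpr (NumberField.discr_ne_zero K)) (Int.natCast_dvd.mp hp)

/-- **The two splitting data agree at squarefree `p`.** If `p𝓞 K` factors without repetition then
`splittingNorms K p = {p^{f₁}, …, p^{f_g}} = (splittingType K p).map (p ^ ·)`, because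
`N(P) = p^{f(P|p)}` (`Ideal.pow_inertiaDeg`). [folklore] -/
theorem splittingNorms_eq_map_of_nodup {p : ℕ} (hp : p.Prime)
    (hnd : (normalizedFactors (span {(p : 𝓞 K)})).Nodup) :
    splittingNorms K p = (splittingType K p).map (p ^ ·) := by
  rw [splittingType, Multiset.dedup_eq_self.mpr hnd, Multiset.map_map, splittingNorms]
  refine Multiset.map_congr rfl fun P hP => ?_
  obtain ⟨hPp, hPl⟩ := (mem_normalizedFactors_span_iff hp).1 hP
  exact (Ideal.pow_inertiaDeg p P).symm

/-- From equal norms data to equal splitting types, at almost all primes: if `splittingNorms K p =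
splittingNorms K' p` for all but finitely many primes `p`, then `p` has the same (Perlis) splitting
type in `K` and `K'` for all but finitely many primes `p` (discard the finitely many `p ∣ D_K D_{K'}`
and use injectivity of `f ↦ p^f`). [folklore] -/
theorem eventually_splittingType_eq_of_splittingNorms {K K' : Type*} [Field K] [NumberField K]
    [Field K'] [NumberField K']
    (h : ∀ᶠ p : ℕ in cofinite, p.Prime → splittingNorms K p = splittingNorms K' p) :
    ∀ᶠ p : ℕ in cofinite, p.Prime → splittingType K p = splittingType K' p := by
  filter_upwards [h, eventually_not_dvd_discr K, eventually_not_dvd_discr K'] with p hn hd hd' hp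
  have e := hn hp
  rw [splittingNorms_eq_map_of_nodup hp (nodup_normalizedFactors_of_not_dvd_discr hp hd),
    splittingNorms_eq_map_of_nodup hp (nodup_normalizedFactors_of_not_dvd_discr hp hd')] at e
  exact Multiset.map_injective (Nat.pow_right_injective hp.two_le) e

/-- From equal splitting types to equal norms data, at almost all primes. [folklore] -/
theorem eventually_splittingNorms_eq_of_splittingType {K K' : Type*} [Field K] [NumberField K]
    [Field K'] [NumberField K']
    (h : ∀ᶠ p : ℕ in cofinite, p.Prime → splittingType K p = splittingType K' p) :
    ∀ᶠ p : ℕ in cofinite, p.Prime → splittingNorms K p = splittingNorms K' p := by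
  filter_upwards [h, eventually_not_dvd_discr K, eventually_not_dvd_discr K'] with p ht hd hd' hp
  rw [splittingNorms_eq_map_of_nodup hp (nodup_normalizedFactors_of_not_dvd_discr hp hd),
    splittingNorms_eq_map_of_nodup hp (nodup_normalizedFactors_of_not_dvd_discr hp hd'), ht hp]

/-- **Condition (c) in either form.** Equality of Perlis splitting types at almost all primes is
equivalent to equality of the norms data `splittingNorms` at almost all primes. [folklore] -/
theorem eventually_splittingType_eq_iff_splittingNorms {K K' : Type*} [Field K] [NumberField K]
    [Field K'] [NumberField K'] :
    (∀ᶠ p : ℕ in cofinite, p.Prime → splittingType K p = splittingType K' p) ↔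
      ∀ᶠ p : ℕ in cofinite, p.Prime → splittingNorms K p = splittingNorms K' p :=
  ⟨eventually_splittingNorms_eq_of_splittingType, eventually_splittingType_eq_of_splittingNorms⟩

/-- An arithmetically equivalent pair has equal norms data at almost all primes (no fact needed:
(b) ⇒ (c) is trivial). [folklore] -/
theorem ArithmeticallyEquivalent.eventually_splittingNorms_eq {K K' : Type*} [Field K]
    [NumberField K] [Field K'] [NumberField K'] (h : ArithmeticallyEquivalent K K') :
    ∀ᶠ p : ℕ in cofinite, p.Prime → splittingNorms K p = splittingNorms K' p :=
  eventually_splittingNorms_eq_of_splittingType (Eventually.of_forall h)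

/-- **The consumer's rendering (route Langlands/E8QuinticResidue, crux `NoChimeras`).** From
Perlis's Theorems 1 and 3: if `[K : ℚ] ≤ 6` and, for all but finitely many primes `p`, the multisets
of norms of the prime factors of `p𝓞 K` and of `p𝓞 K'` coincide, then `K ≅ K'` over `ℚ`
((c) ⇒ (b) by Theorem 1, then Theorem 3). [cite: Perlis1977, Thm. 1 ((c) ⇒ (b)) and Thm. 3] -/
theorem Perlis1977_thm3.algEquiv_of_splittingNorms (h1 : Perlis1977_thm1) (h3 : Perlis1977_thm3)
    {K K' : Type} [Field K] [NumberField K] [Field K'] [NumberField K']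
    (hdeg : Module.finrank ℚ K ≤ 6)
    (h : ∀ᶠ p : ℕ in cofinite, p.Prime → splittingNorms K p = splittingNorms K' p) :
    Nonempty (K ≃ₐ[ℚ] K') :=
  h3 K K' hdeg ((h1 K K').2.1.2 (eventually_splittingType_eq_of_splittingNorms h))

/-- Symmetric variant with the degree bound on `K'`. [cite: Perlis1977, Thm. 1 and Thm. 3] -/
theorem Perlis1977_thm3.algEquiv_of_splittingNorms' (h1 : Perlis1977_thm1) (h3 : Perlis1977_thm3)
    {K K' : Type} [Field K] [NumberField K] [Field K'] [NumberField K']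
    (hdeg : Module.finrank ℚ K' ≤ 6)
    (h : ∀ᶠ p : ℕ in cofinite, p.Prime → splittingNorms K p = splittingNorms K' p) :
    Nonempty (K ≃ₐ[ℚ] K') := by
  have h' : ∀ᶠ p : ℕ in cofinite, p.Prime → splittingNorms K' p = splittingNorms K p :=
    h.mono fun p hp hpp => (hp hpp).symm
  obtain ⟨e⟩ := Perlis1977_thm3.algEquiv_of_splittingNorms h1 h3 hdeg h'
  exact ⟨e.symm⟩

end Proofs

end Literature.NumberTheory.NumberFields
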